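import Summits.Parity.GeneralizedHardyLittlewood.Theorems.LeeYangFibresRelativeDimOneTypeDefs
import Summits.Parity.GeneralizedHardyLittlewood.Theorems.LeeYangFibresRelativeDimOneSplitTranslation
import Summits.Parity.GeneralizedHardyLittlewood.Theorems.LeeYangFibresRelativeDimOneSplitClassMomentsCore
import HarnessLib

/-!
# Type cells: translation and unit-scaling symmetries (crux stmt-Parity-14113 `LeeYangFibres.RelativeDimOne`,
line gallagher-backwards-split, RESHAPED type-conditioned split; aux for stub `stub_typeClassMoments`, part A)

The full type class `typeCell q w a b₀` (residue vectors `c ∈ [0,q)^t` whose incidence types agree with the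
target's at the primes `p ∣ q`, `p ≤ w`) has two symmetries:

* TRANSLATION `c ↦ (a_i n + c_i mod q)_i` (types are invariant under `b ↦ b + n a`, `incType_translate`, and
  only see residues, `incType_eq_at_primeFactor`); hence every sum over the cell is invariant under the translated
  re-indexing (`sum_typeCell_transl`) and `coprimePairs q a b₀ W = W · #{c ∈ cell : gcd(c_i, q) = 1 ∀ i}`
  (`coprimePairs_eq_mul_card`, the registered hook);
* UNIT SCALING `c ↦ (λ c_i mod q)_i`, `gcd(λ, q) = 1` (`incType_smul`); since the units act transitively on
  the units, the completion counts `#{c ∈ cellU : c_i = r}` over the all-coprime part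
  `cellU = {c ∈ cell : gcd(c_j, q) = 1 ∀ j}` of the cell are CONSTANT in the unit `r` (`card_fibre_eq`), so
  `Σ_{c ∈ cellU} F(c_i) = (#cellU / φ(q)) Σ_{r unit} F(r)` (`sum_cellU_apply`) — the identity by which the
  one-deviation terms of the type-class moments collapse to the global prime number theorem.

No definitions are introduced (the maps are written as lambdas, `cellU` as the filter). Reused: `resid_lt`,
`resid_cast`, `coprime_resid_iff` (SplitClassMomentsCore), `incType_translate` (SplitTranslation).
-/

noncomputable section

open scoped BigOperators Classical
open Finset
open Summit.Parity.GeneralizedHardyLittlewood.Cruxes.RelativeDimOne.GallagherBackwardsSplit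
open Summit.Parity.GeneralizedHardyLittlewood.Cruxes.RelativeDimOne.GallagherBackwardsSplit.ClassMomentsCore
  (resid_lt resid_cast coprime_resid_iff)

namespace Summit.Parity.GeneralizedHardyLittlewood.Cruxes.RelativeDimOne.TypeSplit

namespace TCM

variable {t : ℕ}

/-! ### Incidence types only see residues, and are invariant under unit scaling -/

/-- Shift vectors congruent mod `q` have the same incidence type at every prime factor `p` of `q` (the three
families of gcds only see residues: `gcd(x, g) = gcd(x mod g, g)` for `g ∣ p ∣ q`). -/
theorem incType_eq_at_primeFactor {q p : ℕ} (hp : p ∈ q.primeFactors) (a : Fin t → ℤ) {b b' : Fin t → ℤ}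
    (h : ∀ i, b i ≡ b' i [ZMOD q]) : incType p a b = incType p a b' := by
  have hpq : (p : ℤ) ∣ q := Int.natCast_dvd_natCast.2 (Nat.dvd_of_mem_primeFactors hp)
  have hg : ∀ {x y : ℤ} {g : ℕ}, (g : ℤ) ∣ p → x ≡ y [ZMOD q] → Int.gcd x g = Int.gcd y g :=
    fun hgp hxy => by
    rw [← Int.gcd_emod, ((hxy.of_dvd hpq).of_dvd hgp).eq, Int.gcd_emod]
  unfold incType
  refine Prod.ext ?_ ?_
  · funext i
    refine Prod.ext rfl ?_
    dsimp only
    exact hg (Int.gcd_dvd_right (a i) p) (h i)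
  · funext i j
    dsimp only
    exact hg (dvd_refl _) (((h j).mul_left _).sub ((h i).mul_left _))

/-- `gcd(λ b, g) = gcd(b, g)` when `gcd(λ, g) = 1`. -/
theorem int_gcd_mul_left_cancel {l : ℤ} {g : ℕ} (h : Int.gcd l g = 1) (b : ℤ) :
    Int.gcd (l * b) g = Int.gcd b g := by
  rw [Int.gcd_def, Int.gcd_def, Int.natAbs_mul, Int.natAbs_natCast]
  rw [Int.gcd_def, Int.natAbs_natCast] at h
  exact Nat.Coprime.gcd_mul_left_cancel _ h

/-- `gcd(λ, g) = 1` for `g ∣ q` when `gcd(λ, q) = 1`. -/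
theorem int_gcd_eq_one_of_dvd {l : ℤ} {g q : ℕ} (hg : g ∣ q) (h : Int.gcd l q = 1) : Int.gcd l g = 1 := by
  rw [Int.gcd_def, Int.natAbs_natCast] at h ⊢
  exact Nat.Coprime.coprime_dvd_right hg h

/-- The incidence type mod `q` is invariant under scaling the shifts by a unit mod `q`. -/
theorem incType_smul (q : ℕ) (a b : Fin t → ℤ) (l : ℤ) (hl : Int.gcd l q = 1) :
    incType q a (fun i => l * b i) = incType q a b := by
  unfold incType
  refine Prod.ext ?_ ?_
  · funext i
    refine Prod.ext rfl ?_
    dsimp only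
    have hg : Int.gcd (a i) q ∣ q := by
      have := Int.gcd_dvd_right (a i) q
      exact_mod_cast this
    exact int_gcd_mul_left_cancel (int_gcd_eq_one_of_dvd hg hl) _
  · funext i j
    dsimp only
    rw [show a i * (l * b j) - a j * (l * b i) = l * (a i * b j - a j * b i) by ring]
    exact int_gcd_mul_left_cancel (int_gcd_eq_one_of_dvd (dvd_refl q) hl) _

/-! ### Membership in a type cell -/

/-- Membership in `typeCell q w a b₀`. -/
theorem mem_typeCell {q w : ℕ} {a b₀ : Fin t → ℤ} {v : Fin t → ℕ} :
    v ∈ typeCell q w a b₀ ↔ (∀ i, v i < q) ∧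
      ∀ p ∈ q.primeFactors, p ≤ w → incType p a (fun i => (v i : ℤ)) = incType p a b₀ := by
  unfold typeCell
  rw [Finset.mem_filter, Fintype.mem_piFinset]
  simp only [Finset.mem_range]

/-! ### Residues -/

/-- `↑(resid q x) ≡ x (mod q)`. -/
theorem resid_modEq {q : ℕ} (hq : 0 < q) (x : ℤ) : ((resid q x : ℕ) : ℤ) ≡ x [ZMOD q] := by
  rw [resid_cast hq]
  exact Int.mod_modEq x q

/-- `resid q x = c` when `x ≡ c (mod q)` and `c < q`. -/
theorem resid_eq_of_modEq {q : ℕ} {x : ℤ} {c : ℕ} (h : x ≡ (c : ℤ) [ZMOD q]) (hc : c < q) :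
    resid q x = c := by
  unfold resid
  rw [h.eq, Int.emod_eq_of_lt (by exact_mod_cast Nat.zero_le c) (by exact_mod_cast hc), Int.toNat_natCast]

/-- `gcd(n % q, q) = 1 ↔ gcd(n, q) = 1`. -/
theorem coprime_mod_iff (n q : ℕ) : (n % q).Coprime q ↔ n.Coprime q := by
  rw [Nat.Coprime, Nat.Coprime, ← Nat.gcd_rec, Nat.gcd_comm]

/-! ### Translation of the cell by `n · a`: the map `c ↦ (resid q (a_i n + c_i))_i` -/

/-- Translation maps the cell to itself. -/
theorem transl_mem {q w : ℕ} (hq : 0 < q) {a b₀ : Fin t → ℤ} (n : ℤ) {c : Fin t → ℕ}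
    (hc : c ∈ typeCell q w a b₀) : (fun i => resid q (a i * n + c i)) ∈ typeCell q w a b₀ := by
  rw [mem_typeCell] at hc ⊢
  refine ⟨fun i => resid_lt hq _, fun p hp hpw => ?_⟩
  have h1 : incType p a (fun i => ((resid q (a i * n + c i) : ℕ) : ℤ)) =
      incType p a (fun i => (c i : ℤ) + n * a i) := by
    refine incType_eq_at_primeFactor hp a fun i => ?_
    rw [show (c i : ℤ) + n * a i = a i * n + c i by ring]
    exact resid_modEq hq (a i * n + c i)
  rw [h1, incType_translate, hc.2 p hp hpw]

/-- Translating by `n` and then by `-n` is the identity on `[0, q)^t`. -/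
theorem transl_neg_transl {q : ℕ} (hq : 0 < q) (a : Fin t → ℤ) (n : ℤ) {c : Fin t → ℕ}
    (hc : ∀ i, c i < q) :
    (fun i => resid q (a i * (-n) + ((resid q (a i * n + c i) : ℕ) : ℤ))) = c := by
  funext i
  apply resid_eq_of_modEq _ (hc i)
  have h1 := resid_modEq hq (a i * n + c i)
  calc a i * -n + ((resid q (a i * n + c i) : ℕ) : ℤ) ≡ a i * -n + (a i * n + c i) [ZMOD q] :=
        h1.add_left _
    _ = c i := by ring
    _ ≡ c i [ZMOD q] := Int.ModEq.refl _

/-- Translating by `-n` and then by `n` is the identity on `[0, q)^t`. -/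
theorem transl_transl_neg {q : ℕ} (hq : 0 < q) (a : Fin t → ℤ) (n : ℤ) {c : Fin t → ℕ}
    (hc : ∀ i, c i < q) :
    (fun i => resid q (a i * n + ((resid q (a i * (-n) + c i) : ℕ) : ℤ))) = c := by
  have := transl_neg_transl hq a (-n) hc
  rwa [neg_neg] at this

/-- Sums over the cell are invariant under the translated re-indexing. -/
theorem sum_typeCell_transl {M : Type*} [AddCommMonoid M] {q w : ℕ} (hq : 0 < q) (a b₀ : Fin t → ℤ)
    (n : ℤ) (F : (Fin t → ℕ) → M) :
    ∑ c ∈ typeCell q w a b₀, F (fun i => resid q (a i * n + c i)) = ∑ c ∈ typeCell q w a b₀, F c := by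
  refine Finset.sum_nbij' (fun c i => resid q (a i * n + c i)) (fun c i => resid q (a i * (-n) + c i))
    ?_ ?_ ?_ ?_ ?_
  · exact fun c hc => transl_mem hq n hc
  · exact fun c hc => transl_mem hq (-n) hc
  · exact fun c hc => transl_neg_transl hq a n (mem_typeCell.1 hc).1
  · exact fun c hc => transl_transl_neg hq a n (mem_typeCell.1 hc).1
  · exact fun c _ => rfl

/-- The coprime count at shift `n` equals the coprime count of the cell itself. -/
theorem card_filter_coprime_transl {q : ℕ} (hq : 0 < q) (a b₀ : Fin t → ℤ) (n : ℕ) :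
    ((typeCell q q a b₀).filter (fun c => ∀ i, Int.gcd (a i * n + c i) q = 1)).card =
      ((typeCell q q a b₀).filter (fun c => ∀ i, Nat.Coprime (c i) q)).card := by
  rw [Finset.card_filter, Finset.card_filter]
  rw [← sum_typeCell_transl hq a b₀ (n : ℤ) (fun c => if ∀ i, Nat.Coprime (c i) q then 1 else 0)]
  refine Finset.sum_congr rfl fun c _ => ?_
  simp only [← coprime_resid_iff hq]

/-- HOOK (registered): `coprimePairs q a b₀ W = W · #{c ∈ typeCell q q a b₀ : gcd(c_i, q) = 1 ∀ i}` — the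
main-term count of the type-class moments does not move with `n` (translation invariance of the cell). -/
theorem coprimePairs_eq_mul_card : ∀ {t : ℕ} (q : ℕ), 0 < q → ∀ (a b₀ : Fin t → ℤ) (W : ℕ), coprimePairs q a b₀ W = W * ((typeCell q q a b₀).filter (fun c => ∀ i, Nat.Coprime (c i) q)).card := by
  intro t q hq a b₀ W
  unfold coprimePairs
  rw [Finset.sum_congr rfl (fun n _ => card_filter_coprime_transl hq a b₀ n), Finset.sum_const,
    Finset.card_range, smul_eq_mul]

/-! ### Unit scaling of the cell: the map `c ↦ (l c_j % q)_j` -/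

/-- Scaling by a unit maps the cell to itself. -/
theorem scal_mem {q w : ℕ} (hq : 0 < q) {a b₀ : Fin t → ℤ} {l : ℕ} (hl : l.Coprime q) {c : Fin t → ℕ}
    (hc : c ∈ typeCell q w a b₀) : (fun j => (l * c j) % q) ∈ typeCell q w a b₀ := by
  rw [mem_typeCell] at hc ⊢
  refine ⟨fun j => Nat.mod_lt _ hq, fun p hp hpw => ?_⟩
  have hpq' : p ∣ q := Nat.dvd_of_mem_primeFactors hp
  have h1 : incType p a (fun j => (((l * c j) % q : ℕ) : ℤ)) =
      incType p a (fun j => (l : ℤ) * (c j : ℤ)) := by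
    refine incType_eq_at_primeFactor hp a fun j => ?_
    have : (((l * c j % q : ℕ)) : ℤ) = ((l : ℤ) * (c j : ℤ)) % (q : ℤ) := by push_cast; rfl
    rw [this]
    exact Int.mod_modEq _ _
  have hlp : Int.gcd (l : ℤ) p = 1 := by
    rw [Int.gcd_natCast_natCast]
    exact Nat.Coprime.coprime_dvd_right hpq' hl
  rw [h1, incType_smul p a _ (l : ℤ) hlp, hc.2 p hp hpw]

/-- Scaling by `l` and then by an inverse `m` of `l` is the identity on `[0, q)^t`. -/
theorem scal_scal {q l m : ℕ} (hlm : l * m % q = 1 % q) {c : Fin t → ℕ} (hc : ∀ j, c j < q) :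
    (fun j => (m * ((l * c j) % q)) % q) = c := by
  funext j
  have h1 : m * (l * c j % q) % q = m * (l * c j) % q := by
    rw [Nat.mul_mod, Nat.mod_mod, ← Nat.mul_mod]
  rw [h1, show m * (l * c j) = (l * m) * c j by ring, Nat.mul_mod, hlm, ← Nat.mul_mod, one_mul,
    Nat.mod_eq_of_lt (hc j)]

/-- A coordinate of the scaled vector is coprime to `q` iff the original coordinate is. -/
theorem coprime_scal_iff {q l : ℕ} (hl : l.Coprime q) (c : Fin t → ℕ) (j : Fin t) :
    ((l * c j) % q).Coprime q ↔ (c j).Coprime q := by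
  rw [coprime_mod_iff, Nat.coprime_mul_iff_left]
  exact ⟨fun h => h.2, fun h => ⟨hl, h⟩⟩

/-- The completion counts are monotone along the unit action: for units `r, r'` (`r' < q`),
`#{c ∈ cellU : c_i = r} ≤ #{c ∈ cellU : c_i = r'}` (scale by `λ` with `λ r ≡ r'`). -/
theorem card_fibre_le {q w : ℕ} (hq : 0 < q) (a b₀ : Fin t → ℤ) (i : Fin t) {r r' : ℕ}
    (hr : r.Coprime q) (hr' : r' < q) (hr'q : r'.Coprime q) :
    (((typeCell q w a b₀).filter (fun c => ∀ j, Nat.Coprime (c j) q)).filter (fun c => c i = r)).card ≤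
      (((typeCell q w a b₀).filter (fun c => ∀ j, Nat.Coprime (c j) q)).filter (fun c => c i = r')).card := by
  obtain ⟨l, -, hl⟩ := Nat.exists_mul_mod_eq_of_coprime r' hr hq.ne'
  rw [Nat.mod_eq_of_lt hr'] at hl
  -- `l` is a unit
  have hlq : l.Coprime q := by
    have h1 : (r * l % q).Coprime q := by rw [hl]; exact hr'q
    rw [coprime_mod_iff, Nat.coprime_mul_iff_left] at h1
    exact h1.2
  obtain ⟨m, -, hm⟩ := Nat.exists_mul_mod_eq_of_coprime 1 hlq hq.ne'
  refine Finset.card_le_card_of_injOn (fun c j => (l * c j) % q) ?_ ?_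
  · intro c hc
    rw [Finset.mem_coe, Finset.mem_filter, Finset.mem_filter] at hc ⊢
    refine ⟨⟨scal_mem hq hlq hc.1.1, fun j => (coprime_scal_iff hlq c j).2 (hc.1.2 j)⟩, ?_⟩
    show l * c i % q = r'
    rw [hc.2, mul_comm, hl]
  · intro c hc c' hc' h
    rw [Finset.mem_coe, Finset.mem_filter, Finset.mem_filter] at hc hc'
    have h1 := scal_scal hm (mem_typeCell.1 hc.1.1).1
    have h2 := scal_scal hm (mem_typeCell.1 hc'.1.1).1
    rw [← h1, ← h2]
    funext j
    have := congrFun h j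
    dsimp only at this
    rw [this]

/-- The completion counts are CONSTANT on the units: `#{c ∈ cellU : c_i = r} = #{c ∈ cellU : c_i = r'}`
for units `r, r' < q`. -/
theorem card_fibre_eq {q w : ℕ} (hq : 0 < q) (a b₀ : Fin t → ℤ) (i : Fin t) {r r' : ℕ}
    (hr : r < q) (hrq : r.Coprime q) (hr' : r' < q) (hr'q : r'.Coprime q) :
    (((typeCell q w a b₀).filter (fun c => ∀ j, Nat.Coprime (c j) q)).filter (fun c => c i = r)).card =
      (((typeCell q w a b₀).filter (fun c => ∀ j, Nat.Coprime (c j) q)).filter (fun c => c i = r')).card :=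
  le_antisymm (card_fibre_le hq a b₀ i hrq hr' hr'q) (card_fibre_le hq a b₀ i hr'q hr hrq)

/-- The units of `[0, q)`. -/
theorem card_units_eq_totient (q : ℕ) :
    ((Finset.range q).filter (fun r => r.Coprime q)).card = Nat.totient q := by
  rw [Nat.totient_eq_card_coprime]
  congr 1
  exact Finset.filter_congr fun r _ => Nat.coprime_comm

/-- The fibres over the units exhaust `cellU`: `Σ_{r unit} #{c ∈ cellU : c_i = r} = #cellU`. -/
theorem sum_card_fibre {q w : ℕ} (a b₀ : Fin t → ℤ) (i : Fin t) :
    ∑ r ∈ (Finset.range q).filter (fun r => r.Coprime q),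
        (((typeCell q w a b₀).filter (fun c => ∀ j, Nat.Coprime (c j) q)).filter (fun c => c i = r)).card =
      ((typeCell q w a b₀).filter (fun c => ∀ j, Nat.Coprime (c j) q)).card := by
  symm
  refine Finset.card_eq_sum_card_fiberwise fun c hc => ?_
  rw [Finset.mem_coe, Finset.mem_filter] at hc
  rw [Finset.mem_coe, Finset.mem_filter, Finset.mem_range]
  exact ⟨(mem_typeCell.1 hc.1).1 i, hc.2 i⟩

/-- Each unit fibre carries the fraction `1/φ(q)` of `cellU`: `#{c ∈ cellU : c_i = r} · φ(q) = #cellU`. -/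
theorem card_fibre_mul_totient {q w : ℕ} (hq : 0 < q) (a b₀ : Fin t → ℤ) (i : Fin t) {r : ℕ}
    (hr : r < q) (hrq : r.Coprime q) :
    (((typeCell q w a b₀).filter (fun c => ∀ j, Nat.Coprime (c j) q)).filter (fun c => c i = r)).card *
        Nat.totient q =
      ((typeCell q w a b₀).filter (fun c => ∀ j, Nat.Coprime (c j) q)).card := by
  rw [← sum_card_fibre a b₀ i, ← card_units_eq_totient, mul_comm, Finset.card_eq_sum_ones,
    Finset.sum_mul, one_mul]
  refine Finset.sum_congr rfl fun r' hr' => ?_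
  rw [Finset.mem_filter, Finset.mem_range] at hr'
  exact card_fibre_eq hq a b₀ i hr hrq hr'.1 hr'.2

/-- THE COLLAPSE IDENTITY: a function of one coordinate sums over `cellU` to `#cellU/φ(q)` times its sum
over the units: `Σ_{c ∈ cellU} F(c_i) = (#cellU / φ(q)) · Σ_{r < q, gcd(r,q)=1} F(r)`. -/
theorem sum_cellU_apply {q w : ℕ} (hq : 0 < q) (a b₀ : Fin t → ℤ) (i : Fin t) (F : ℕ → ℝ) :
    ∑ c ∈ (typeCell q w a b₀).filter (fun c => ∀ j, Nat.Coprime (c j) q), F (c i) =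
      (((typeCell q w a b₀).filter (fun c => ∀ j, Nat.Coprime (c j) q)).card : ℝ) / (Nat.totient q : ℝ) *
        ∑ r ∈ (Finset.range q).filter (fun r => r.Coprime q), F r := by
  have hφ : (0 : ℝ) < Nat.totient q := by exact_mod_cast Nat.totient_pos.2 hq
  have hmaps : ∀ c ∈ (typeCell q w a b₀).filter (fun c => ∀ j, Nat.Coprime (c j) q),
      c i ∈ (Finset.range q).filter (fun r => r.Coprime q) := by
    intro c hc
    rw [Finset.mem_filter] at hc
    rw [Finset.mem_filter, Finset.mem_range]
    exact ⟨(mem_typeCell.1 hc.1).1 i, hc.2 i⟩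
  rw [← Finset.sum_fiberwise_of_maps_to hmaps, Finset.mul_sum]
  refine Finset.sum_congr rfl fun r hr => ?_
  rw [Finset.mem_filter, Finset.mem_range] at hr
  have h1 : ∑ c ∈ ((typeCell q w a b₀).filter (fun c => ∀ j, Nat.Coprime (c j) q)).filter
        (fun c => c i = r), F (c i) =
      ∑ c ∈ ((typeCell q w a b₀).filter (fun c => ∀ j, Nat.Coprime (c j) q)).filter
        (fun c => c i = r), F r := by
    refine Finset.sum_congr rfl fun c hc => ?_
    rw [(Finset.mem_filter.1 hc).2]
  rw [h1, Finset.sum_const, nsmul_eq_mul]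
  have h2 : (((((typeCell q w a b₀).filter (fun c => ∀ j, Nat.Coprime (c j) q)).filter
        (fun c => c i = r)).card : ℕ) : ℝ) * (Nat.totient q : ℝ) =
      (((typeCell q w a b₀).filter (fun c => ∀ j, Nat.Coprime (c j) q)).card : ℝ) := by
    exact_mod_cast card_fibre_mul_totient hq a b₀ i hr.1 hr.2
  rw [← h2]
  field_simp

end TCM

end Summit.Parity.GeneralizedHardyLittlewood.Cruxes.RelativeDimOne.TypeSplit

end
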